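import Mathlib

/-!
# Route `GreenTaoLevelTwo`, crux `MNTwo` (stmt-Parity-21276), line `birth`, stub `stub_mnVertical`:
# the Cauchy–Schwarz "`b()`-elimination" inequalities (GT 2008b App. A Lemma 38, first two forms)

Tool for block V4 / H3 (= AIF §10 Lemma 24 "Type II sum implies major arc") of the `stub_mnVertical`
census (B. Green, T. Tao, *Quadratic uniformity of the Möbius function*, Ann. Inst. Fourier 58
(2008) = arXiv:math/0606087, App. A Lemma 38 "Cauchy–Schwarz inequality":
`|𝔼_x 𝔼_y b(x) f(x,y)| ≪ |𝔼_x 𝔼_{y,y'} f(x,y)conj f(x,y')|^{1/2}` and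
`|𝔼_x 𝔼_y b(x) b(y) f(x,y)| ≪ |𝔼_{x,x'} 𝔼_{y,y'} f(x,y) conj f(x,y') conj f(x',y) f(x',y')|^{1/4}`
for `1`-bounded `b`; used in the proof of Lemma 24 "to eliminate the `b(l)b(m)` factors").
Def-free, with plain finite sums and exact constants:

* `norm_sq_sum_eq_re_sum_sum` — `‖∑_y g(y)‖² = Re ∑_{y,y'} g(y) conj g(y')`;
* `norm_sq_sum_sum_le` — first form: `‖∑_x∑_y b(x)f(x,y)‖² ≤ #X · ∑_x ‖∑_y f(x,y)‖²`;
* `norm_pow_four_sum_sum_le` — second form: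
  `‖∑_x∑_y b(x)b'(y)f(x,y)‖⁴ ≤ #X²·#Y²·Re ∑_{x,x',y,y'} f(x,y)conj f(x,y')conj f(x',y)f(x',y')`.

References: [GreenTao2008QuadraticMobius] arXiv:math/0606087 App. A Lemma 38; §10 (Lemma 24).
-/

open Finset
open scoped ComplexConjugate

namespace Summit.Parity.GeneralizedHardyLittlewood.GreenTaoLevelTwoMNTwoCauchySchwarz

variable {X Y : Type*}

/-- `‖∑_y g(y)‖² = Re ∑_y ∑_{y'} g(y) conj g(y')`. [folklore] -/
theorem norm_sq_sum_eq_re_sum_sum (t : Finset Y) (g : Y → ℂ) :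
    ‖∑ y ∈ t, g y‖ ^ 2 = (∑ y ∈ t, ∑ y' ∈ t, g y * conj (g y')).re := by
  have h : ∑ y ∈ t, ∑ y' ∈ t, g y * conj (g y') = (∑ y ∈ t, g y) * conj (∑ y ∈ t, g y) := by
    rw [map_sum, Finset.sum_mul_sum]
  rw [h, Complex.mul_conj, Complex.ofReal_re, Complex.normSq_eq_norm_sq]

/-- `(∑_x a(x))² ≤ #X ∑_x a(x)²`. [folklore] -/
theorem sq_sum_le_card_mul_sum_sq' (s : Finset X) (a : X → ℝ) :
    (∑ x ∈ s, a x) ^ 2 ≤ #s * ∑ x ∈ s, a x ^ 2 := by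
  have h := Finset.sum_mul_sq_le_sq_mul_sq s (fun _ => (1 : ℝ)) a
  simp only [one_pow, Finset.sum_const, nsmul_eq_mul, mul_one, one_mul] at h
  exact h

/-- **Lemma 38, first form**: for `‖b(x)‖ ≤ 1` on `X`,
`‖∑_x ∑_y b(x) f(x,y)‖² ≤ #X · ∑_x ‖∑_y f(x,y)‖²`.
[cite: GreenTao2008QuadraticMobius, App. A Lemma 38 (first claim)] -/
theorem norm_sq_sum_sum_le (s : Finset X) (t : Finset Y) (b : X → ℂ) (hb : ∀ x ∈ s, ‖b x‖ ≤ 1)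
    (f : X → Y → ℂ) :
    ‖∑ x ∈ s, ∑ y ∈ t, b x * f x y‖ ^ 2 ≤ #s * ∑ x ∈ s, ‖∑ y ∈ t, f x y‖ ^ 2 := by
  have h1 : ‖∑ x ∈ s, ∑ y ∈ t, b x * f x y‖ ≤ ∑ x ∈ s, ‖∑ y ∈ t, f x y‖ := by
    refine (norm_sum_le _ _).trans (Finset.sum_le_sum fun x hx => ?_)
    rw [← Finset.mul_sum, norm_mul]
    calc ‖b x‖ * ‖∑ y ∈ t, f x y‖ ≤ 1 * ‖∑ y ∈ t, f x y‖ :=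
          mul_le_mul_of_nonneg_right (hb x hx) (norm_nonneg _)
      _ = ‖∑ y ∈ t, f x y‖ := one_mul _
  calc ‖∑ x ∈ s, ∑ y ∈ t, b x * f x y‖ ^ 2 ≤ (∑ x ∈ s, ‖∑ y ∈ t, f x y‖) ^ 2 :=
        pow_le_pow_left₀ (norm_nonneg _) h1 2
    _ ≤ #s * ∑ x ∈ s, ‖∑ y ∈ t, f x y‖ ^ 2 := sq_sum_le_card_mul_sum_sq' s _

/-- **Lemma 38, second form**: for `‖b(x)‖, ‖b'(y)‖ ≤ 1`,
`‖∑_x ∑_y b(x) b'(y) f(x,y)‖⁴ ≤ #X² · #Y² · Re ∑_x ∑_{x'} ∑_y ∑_{y'} f(x,y) conj f(x,y') conj f(x',y) f(x',y')`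
(the right-hand sum is real and nonnegative).
[cite: GreenTao2008QuadraticMobius, App. A Lemma 38 (second claim)] -/
theorem norm_pow_four_sum_sum_le (s : Finset X) (t : Finset Y) (b : X → ℂ) (b' : Y → ℂ)
    (hb : ∀ x ∈ s, ‖b x‖ ≤ 1) (hb' : ∀ y ∈ t, ‖b' y‖ ≤ 1) (f : X → Y → ℂ) :
    ‖∑ x ∈ s, ∑ y ∈ t, b x * b' y * f x y‖ ^ 4 ≤
      (#s : ℝ) ^ 2 * (#t : ℝ) ^ 2 *
        (∑ x ∈ s, ∑ x' ∈ s, ∑ y ∈ t, ∑ y' ∈ t,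
          f x y * conj (f x y') * conj (f x' y) * f x' y').re := by
  -- Step 1: first form in `x`, with `f` replaced by `b'(y) f(x,y)`
  have h1 : ‖∑ x ∈ s, ∑ y ∈ t, b x * b' y * f x y‖ ^ 2 ≤
      #s * ∑ x ∈ s, ‖∑ y ∈ t, b' y * f x y‖ ^ 2 := by
    have := norm_sq_sum_sum_le s t b hb (fun x y => b' y * f x y)
    simpa only [mul_assoc] using this
  -- Step 2: expand the squares and interchange: `∑_x ‖∑_y b' f‖² = Re ∑_{y,y'} b'(y)conj b'(y') h(y,y')`
  set h : Y → Y → ℂ := fun y y' => ∑ x ∈ s, f x y * conj (f x y') with hh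
  have h2 : ∑ x ∈ s, ‖∑ y ∈ t, b' y * f x y‖ ^ 2 =
      (∑ y ∈ t, ∑ y' ∈ t, b' y * conj (b' y') * h y y').re := by
    rw [Finset.sum_congr rfl fun x _ => norm_sq_sum_eq_re_sum_sum t (fun y => b' y * f x y),
      ← Complex.re_sum]
    congr 1
    rw [Finset.sum_comm]
    refine Finset.sum_congr rfl fun y _ => ?_
    rw [Finset.sum_comm]
    refine Finset.sum_congr rfl fun y' _ => ?_
    rw [hh, Finset.mul_sum]
    refine Finset.sum_congr rfl fun x _ => ?_
    rw [map_mul]; ring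
  -- Step 3: `|Re ∑_{y,y'} b' conj b' h| ≤ ∑_{y,y'} ‖h(y,y')‖`
  have h3 : (∑ y ∈ t, ∑ y' ∈ t, b' y * conj (b' y') * h y y').re ≤
      ∑ y ∈ t, ∑ y' ∈ t, ‖h y y'‖ := by
    refine (Complex.re_le_norm _).trans ((norm_sum_le _ _).trans (Finset.sum_le_sum fun y hy =>
      (norm_sum_le _ _).trans (Finset.sum_le_sum fun y' hy' => ?_)))
    rw [norm_mul, norm_mul, Complex.norm_conj]
    calc ‖b' y‖ * ‖b' y'‖ * ‖h y y'‖ ≤ 1 * 1 * ‖h y y'‖ :=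
          mul_le_mul_of_nonneg_right (mul_le_mul (hb' y hy) (hb' y' hy') (norm_nonneg _)
            zero_le_one) (norm_nonneg _)
      _ = ‖h y y'‖ := by ring
  -- Step 4: Cauchy–Schwarz over the pairs `(y,y')`
  have h4 : (∑ y ∈ t, ∑ y' ∈ t, ‖h y y'‖) ^ 2 ≤ (#t : ℝ) ^ 2 * ∑ y ∈ t, ∑ y' ∈ t, ‖h y y'‖ ^ 2 := by
    have := sq_sum_le_card_mul_sum_sq' (t ×ˢ t) (fun p => ‖h p.1 p.2‖)
    rw [Finset.sum_product, Finset.sum_product, Finset.card_product] at this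
    push_cast at this
    linarith [this]
  -- Step 5: `‖h(y,y')‖² = Re ∑_{x,x'} f(x,y)conj f(x,y') conj(f(x',y)conj f(x',y'))`
  have reorder : ∀ T : X → X → Y → Y → ℂ,
      ∑ y ∈ t, ∑ y' ∈ t, ∑ x ∈ s, ∑ x' ∈ s, T x x' y y' =
        ∑ x ∈ s, ∑ x' ∈ s, ∑ y ∈ t, ∑ y' ∈ t, T x x' y y' := by
    intro T
    calc ∑ y ∈ t, ∑ y' ∈ t, ∑ x ∈ s, ∑ x' ∈ s, T x x' y y'
        = ∑ y ∈ t, ∑ x ∈ s, ∑ y' ∈ t, ∑ x' ∈ s, T x x' y y' :=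
          Finset.sum_congr rfl fun y _ => Finset.sum_comm
      _ = ∑ x ∈ s, ∑ y ∈ t, ∑ y' ∈ t, ∑ x' ∈ s, T x x' y y' := Finset.sum_comm
      _ = ∑ x ∈ s, ∑ y ∈ t, ∑ x' ∈ s, ∑ y' ∈ t, T x x' y y' :=
          Finset.sum_congr rfl fun x _ => Finset.sum_congr rfl fun y _ => Finset.sum_comm
      _ = ∑ x ∈ s, ∑ x' ∈ s, ∑ y ∈ t, ∑ y' ∈ t, T x x' y y' :=
          Finset.sum_congr rfl fun x _ => Finset.sum_comm
  have h5 : ∑ y ∈ t, ∑ y' ∈ t, ‖h y y'‖ ^ 2 =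
      (∑ x ∈ s, ∑ x' ∈ s, ∑ y ∈ t, ∑ y' ∈ t,
        f x y * conj (f x y') * conj (f x' y) * f x' y').re := by
    rw [Finset.sum_congr rfl fun y _ => Finset.sum_congr rfl fun y' _ =>
      norm_sq_sum_eq_re_sum_sum s (fun x => f x y * conj (f x y'))]
    simp only [← Complex.re_sum]
    congr 1
    refine (reorder (fun x x' y y' => f x y * conj (f x y') * conj (f x' y * conj (f x' y')))).trans
      ?_
    refine Finset.sum_congr rfl fun x _ => Finset.sum_congr rfl fun x' _ =>
      Finset.sum_congr rfl fun y _ => Finset.sum_congr rfl fun y' _ => ?_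
    rw [map_mul, Complex.conj_conj]; ring
  -- assemble
  have hA : 0 ≤ ∑ x ∈ s, ‖∑ y ∈ t, b' y * f x y‖ ^ 2 := Finset.sum_nonneg fun _ _ => by positivity
  have hB : 0 ≤ ∑ y ∈ t, ∑ y' ∈ t, ‖h y y'‖ :=
    Finset.sum_nonneg fun _ _ => Finset.sum_nonneg fun _ _ => norm_nonneg _
  have h23 : ∑ x ∈ s, ‖∑ y ∈ t, b' y * f x y‖ ^ 2 ≤ ∑ y ∈ t, ∑ y' ∈ t, ‖h y y'‖ := by
    rw [h2]; exact h3
  calc ‖∑ x ∈ s, ∑ y ∈ t, b x * b' y * f x y‖ ^ 4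
      = (‖∑ x ∈ s, ∑ y ∈ t, b x * b' y * f x y‖ ^ 2) ^ 2 := by ring
    _ ≤ ((#s : ℝ) * ∑ x ∈ s, ‖∑ y ∈ t, b' y * f x y‖ ^ 2) ^ 2 :=
        pow_le_pow_left₀ (by positivity) h1 2
    _ ≤ ((#s : ℝ) * ∑ y ∈ t, ∑ y' ∈ t, ‖h y y'‖) ^ 2 :=
        pow_le_pow_left₀ (by positivity) (mul_le_mul_of_nonneg_left h23 (by positivity)) 2
    _ = (#s : ℝ) ^ 2 * (∑ y ∈ t, ∑ y' ∈ t, ‖h y y'‖) ^ 2 := by ring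
    _ ≤ (#s : ℝ) ^ 2 * ((#t : ℝ) ^ 2 * ∑ y ∈ t, ∑ y' ∈ t, ‖h y y'‖ ^ 2) :=
        mul_le_mul_of_nonneg_left h4 (by positivity)
    _ = _ := by rw [h5]; ring

end Summit.Parity.GeneralizedHardyLittlewood.GreenTaoLevelTwoMNTwoCauchySchwarz
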